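import Summits.BirchSwinnertonDyer.BirchSwinnertonDyer.Theorems.PublishedInputsGreenbergLemma34HTwoCount
import Summits.BirchSwinnertonDyer.BirchSwinnertonDyer.Theorems.PublishedInputsGreenbergLayerHTwoDuality
import Summits.BirchSwinnertonDyer.BirchSwinnertonDyer.Theorems.ByReductionTypeAtTwoGoodOrdTowerControlDualCount
import HarnessLib

set_option linter.dupNamespace false -- `…BirchSwinnertonDyer.BirchSwinnertonDyer…` is the cell's nested layout (D-0017)
set_option autoImplicit false

/-!
# Greenberg LNM 1716 Lemma 3.4 at the layers `n ≥ 1`, brick 6: the EXACT count `#H²(H, Ê[p^k]) = #(Ê[p^k])^τ` over an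
# OPEN subgroup `H ≤ Γ_F` containing the Frobenius `τ` (Greenberg's Prop. 2.5 count over the completed layer `(F_n)_{v_n}`)

Seat `bsd-inputs-k4-p1` (gen 6; LADDER-BSD D-0154 KEY (147)(f) «prove the printed input», row 1 K4 INPUTS; Greenberg
1999), `--supports stmt-BirchSwinnertonDyer-20309`. THEOREMS ONLY (no definition, no named fact, no `sorry`).

R. Greenberg, LNM 1716 (1999), §2 pp. 78–80 (Prop. 2.5 via Poitou–Tate: "`H²(M, C)` is dual to `Hom_{G_M}(C, μ_{p^∞})`",
with `χψ⁻¹ = φ` unramified, so the count over ANY finite layer `M ⊇ F_v` of the cyclotomic tower is `|Ẽ(m)_p|`; over `ℚ`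
the residue field of the layer is `𝔽_p` at every level). Gen 5 proved the count at the layer `0`
(`InputsGreenbergLemma34.natCard_H2_formalTorsion_eq_natCard_fixed`: `#H²(Γ_F, C) = #{c ∈ C : τ c = c}`); cell bsd-2adic has the
INEQUALITY over an open subgroup (BRICK D + `natCard_equivariant_le_card_filter`). Here, for an open normal `H ≤ Γ_F`
containing `τ`, the EQUALITY by a sandwich:
`#(C)^τ = #H²(Γ_F, C) = #Hom_Γ(C, μ) ≤ #Hom_H(C, μ) = #H²(H, C)` (gen 5, Tate duality, brick 2 of this seat) and
`#Hom_H(C, μ) ≤ #{i < p^k : τ(iP) = iP} = #(C)^τ` (bsd-2adic's count, `τ ∈ H`):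

* `natCard_H2_restrict_formalTorsion_eq_natCard_fixed` — **`#H²(H, C) = #{c ∈ C : τ c = c}`** for every open normal
  `H ≤ Γ_F` with `τ ∈ H`, in the abstract `red₀`-currency of gen 5's theorem.

HONEST FRAMING: a local TOOL theorem with displayed hypotheses; closes nothing; no summit statement is proved; BSD is
not proved by any of this.

References: [GreenbergLNM1716] §2 pp. 78–80 (Prop. 2.5), §3 Lemma 3.4 (p. 89); [MilneADT2006] I Cor. 2.3;
[SerreGaloisCohomology1997] I §2.5.
-/

noncomputable section

open scoped Classical AddSubgroup

universe u v

namespace Summit.BirchSwinnertonDyer.BirchSwinnertonDyer.Theorems.InputsGreenbergLemma34Layer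

open Field Literature.NumberTheory.GaloisRepresentations
  Literature.NumberTheory.GaloisRepresentations.DiscreteGaloisModule _root_.ContinuousCohomology WeierstrassCurve
  Summit.BirchSwinnertonDyer.BirchSwinnertonDyer.Theorems.InputsGreenbergLemma34
  Summit.BirchSwinnertonDyer.BirchSwinnertonDyer.Theorems.GoodOrdTower
open Literature.NumberTheory.EllipticCurves hiding subgroupIncl

variable {K : Type u} [Field K] (W : WeierstrassCurve K) [W.IsElliptic]
  (F : Type u) [Field F] [ValuativeRel F] [TopologicalSpace F] [IsNonarchimedeanLocalField F] [CharZero F]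
  [Algebra K F] {p : ℕ} [hp : Fact p.Prime]

set_option maxHeartbeats 1600000 in
/-- **`#H²(H, Ê[p^k]) = #(Ê[p^k])^τ` over an open normal subgroup `H ≤ Γ_F` containing `τ`** — Greenberg's Prop. 2.5 /
Lemma 3.4 count at a finite layer. Setting of gen 5's `natCard_H2_formalTorsion_eq_natCard_fixed` (`F` a non-archimedean
local field of characteristic `0` over `K`, `W/K` elliptic, abstract reduction `red₀` with the ordinary-filtration package
`hstab`/`hgenr`/`hsurj`, a Frobenius `τ` fixing `μ_{p^∞}` with the Hensel property `hHensel`, `C = ker red₀ ∩ E(K̄_F)[p^k]`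
carried by `ρ`), plus an open normal `H ≤ Γ_F` with `τ ∈ H`. Then `#H²(H, C) = #{c ∈ C : τ c = c}`. Sandwich:
`#C^τ = #H²(Γ_F, C) = #Hom_Γ(C, μ) ≤ #Hom_H(C, μ) = #H²(H, C)` and `#Hom_H(C, μ) ≤ #{i < p^k : τ(iP) = iP} = #C^τ`.
[cite: GreenbergLNM1716, §2 Prop. 2.5 (pp. 78–80), §3 Lemma 3.4 (p. 89)] [cite: MilneADT2006, I Cor. 2.3]
[cite: SerreGaloisCohomology1997, I §2.5 Prop. 10] -/
theorem natCard_H2_restrict_formalTorsion_eq_natCard_fixed {B : Type v} [AddCommGroup B]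
    (red₀ : localPoints W F →+ B)
    (hstab : ∀ (σ : absoluteGaloisGroup F) (Q : localPoints W F), red₀ Q = 0 → red₀ (σ • Q) = 0)
    (hgenr : ∀ r : ℕ, ∃ P₁ : localPoints W F, red₀ P₁ = 0 ∧ addOrderOf P₁ = p ^ r ∧
      ∀ P : localPoints W F, red₀ P = 0 → ((p ^ r : ℕ) : ℤ) • P = 0 → ∃ c : ℕ, P = c • P₁)
    (hsurj : ∀ (r : ℕ) (y : B), ((p ^ r : ℕ) : ℤ) • y = 0 →
      ∃ x : localPoints W F, ((p ^ r : ℕ) : ℤ) • x = 0 ∧ red₀ x = y)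
    {τ : absoluteGaloisGroup F} (hτfix : ∀ (r : ℕ) (ξ : AlgebraicClosure F), ξ ^ p ^ r = 1 → τ • ξ = ξ)
    (hHensel : ∀ Q : localPoints W F, red₀ (τ • Q) = red₀ Q →
      ∃ P₀ : localPoints W F, (∀ σ : absoluteGaloisGroup F, σ • P₀ = P₀) ∧ red₀ P₀ = red₀ Q)
    (k : ℕ) (C : AddSubgroup (localPoints W F)) (hC : ∀ a, a ∈ C ↔ red₀ a = 0 ∧ p ^ k • a = 0)
    (ρ : ContinuousRep (absoluteGaloisGroup F) ℤ C)
    (hρ : ∀ (σ : absoluteGaloisGroup F) (c : C), ((ρ σ c : C) : localPoints W F) = σ • (c : localPoints W F))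
    (H : Subgroup (absoluteGaloisGroup F)) [H.Normal] (hHo : IsOpen (H : Set (absoluteGaloisGroup F))) (hτH : τ ∈ H) :
    Finite (continuousCohomology 2 (ρ.restrict (subgroupIncl H)).toTopRep) ∧
      Nat.card (continuousCohomology 2 (ρ.restrict (subgroupIncl H)).toTopRep) =
        Nat.card {c : C // τ • (c : localPoints W F) = c} := by
  -- notation
  let P : Type u := localPoints W F
  let Γ := absoluteGaloisGroup F
  haveI : NeZero (p ^ k) := ⟨pow_ne_zero k hp.out.ne_zero⟩
  have galois_smul_nsmul : ∀ (σ : Γ) (n : ℕ) (Q : P), σ • (n • Q) = n • (σ • Q) :=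
    fun σ n Q ↦ map_nsmul (DistribSMul.toAddMonoidHom P σ) n Q
  -- the generator `P_k` of `C`
  obtain ⟨Pk, hPk0, hPkord, hPkgen⟩ := hgenr k
  have hPkp : p ^ k • Pk = 0 := by rw [← hPkord]; exact addOrderOf_nsmul_eq_zero Pk
  have hPkC : Pk ∈ C := (hC Pk).mpr ⟨hPk0, hPkp⟩
  let Pz : C := ⟨Pk, hPkC⟩
  have hZgen : ∀ z : C, ∃ i : ℕ, z = i • Pz := fun z ↦ by
    obtain ⟨c, hc⟩ := hPkgen z ((hC z).mp z.2).1 (by rw [natCast_zsmul]; exact ((hC z).mp z.2).2)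
    exact ⟨c, Subtype.ext (by rw [AddSubmonoidClass.coe_nsmul]; exact hc)⟩
  have hPzord : addOrderOf Pz = p ^ k := by rw [← AddSubgroup.addOrderOf_coe Pz]; exact hPkord
  have hZcard : Nat.card C = p ^ k := by
    have h : (AddSubgroup.zmultiples Pz : AddSubgroup C) = ⊤ := by
      rw [eq_top_iff]
      intro z _
      obtain ⟨i, hi⟩ := hZgen z
      exact hi ▸ AddSubgroup.nsmul_mem _ (AddSubgroup.mem_zmultiples Pz) i
    rw [← hPzord, ← Nat.card_zmultiples Pz, h, AddSubgroup.card_top]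
  haveI hZfin : Finite C := Nat.finite_of_card_ne_zero (by rw [hZcard]; exact pow_ne_zero k hp.out.ne_zero)
  have hZp : ∀ z : C, p ^ k • z = 0 := fun z ↦ Subtype.ext (by
    rw [AddSubmonoidClass.coe_nsmul, ZeroMemClass.coe_zero]; exact ((hC z).mp z.2).2)
  -- `τ P_k = b P_k`, `τ` trivial on `μ_{p^k}`
  obtain ⟨b, hb⟩ := hPkgen (τ • Pk) (hstab τ Pk hPk0) (by rw [natCast_zsmul, ← galois_smul_nsmul, hPkp, smul_zero])
  have hb' : ρ τ Pz = b • Pz := Subtype.ext (by rw [hρ, AddSubmonoidClass.coe_nsmul]; exact hb)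
  have hτω : ∀ z : MuCarrier F (p ^ k), mu F (p ^ k) τ z = z := by
    intro z
    have hu1 : (((MuCarrier.toAdditive z).toMul : (AlgebraicClosure F)ˣ) : AlgebraicClosure F) ^ p ^ k = 1 := by
      have h' := ((MuCarrier.toAdditive z).toMul).2
      rw [mem_rootsOfUnity] at h'
      rw [← Units.val_pow_eq_pow_val, h', Units.val_one]
    apply MuCarrier.toAdditive.injective
    rw [mu_apply_apply]
    refine congrArg Additive.ofMul (Subtype.ext (Units.ext ?_))
    rw [absoluteGaloisGroup.coe_smul_rootsOfUnity, Units.coe_smul]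
    exact hτfix k _ hu1
  -- (0) the layer-`0` count (gen 5) and Tate duality over `Γ_F`
  obtain ⟨-, hΓ⟩ := natCard_H2_formalTorsion_eq_natCard_fixed W F red₀ hstab hgenr hsurj hτfix hHensel k C hC ρ hρ
  obtain ⟨-, hdualΓ⟩ := natCard_two_eq_natCard_invariants_homRep F ρ hZp
  -- (1) `#H²(H, C) = #Hom_H(C, μ)` (brick 2)
  obtain ⟨hfinH, hH⟩ := finite_and_natCard_two_restrict_eq F H hHo ρ hZp
  refine ⟨hfinH, ?_⟩
  rw [hH]
  -- the finite type of `H`-equivariant maps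
  haveI hfinS : Finite {f : C →+ MuCarrier F (p ^ k) // ∀ (h : H) (m : C),
      f (ρ (h : Γ) m) = mu F (p ^ k) (h : Γ) (f m)} := by
    haveI : Finite (MuCarrier F (p ^ k)) := Finite.of_equiv _ (muEquivZMod F (p ^ k)).toEquiv.symm
    haveI : Finite (C →+ MuCarrier F (p ^ k)) := Finite.of_injective (fun f : C →+ MuCarrier F (p ^ k) ↦ (f : C → _))
      (fun f g h ↦ AddMonoidHom.ext fun m ↦ congrFun h m)
    exact Finite.of_injective _ Subtype.val_injective
  -- (2) upper bound: `#Hom_H(C, μ) ≤ #{i < p^k : τ(iP) = iP} = #C^τ`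
  have hnsmul : ∀ i j : ℕ, i • Pz = j • Pz ↔ (i : ZMod (p ^ k)) = (j : ZMod (p ^ k)) := fun i j ↦ by
    rw [nsmul_eq_nsmul_iff_modEq, hPzord, ZMod.natCast_eq_natCast_iff]
  have hρτ : ∀ c : C, (ρ τ c = c) ↔ τ • (c : P) = c := fun c ↦ by
    rw [← hρ]; exact ⟨fun h ↦ congrArg Subtype.val h, fun h ↦ Subtype.ext h⟩
  -- `i ↦ i • P_k` is a bijection from `{i < p^k : τ(iP) = iP}` onto `{c : τ c = c}` (for any decidability instance)
  have hcount : ∀ inst : DecidablePred fun i : ℕ ↦ ρ τ (i • Pz) = i • Pz,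
      (@Finset.filter ℕ (fun i : ℕ ↦ ρ τ (i • Pz) = i • Pz) inst (Finset.range (p ^ k))).card =
        Nat.card {c : C // τ • (c : P) = c} := by
    intro inst
    rw [← Nat.card_eq_finsetCard]
    refine Nat.card_congr (Equiv.ofBijective (fun i ↦ ⟨i.1 • Pz, (hρτ _).mp
      ((@Finset.mem_filter ℕ _ inst _ _).mp i.2).2⟩) ⟨?_, ?_⟩)
    · rintro ⟨i, hi⟩ ⟨j, hj⟩ hij
      have hi' := Finset.mem_range.mp ((@Finset.mem_filter ℕ _ inst _ _).mp hi).1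
      have hj' := Finset.mem_range.mp ((@Finset.mem_filter ℕ _ inst _ _).mp hj).1
      have h := (hnsmul i j).mp (congrArg Subtype.val hij :)
      rw [ZMod.natCast_eq_natCast_iff, Nat.ModEq, Nat.mod_eq_of_lt hi', Nat.mod_eq_of_lt hj'] at h
      exact Subtype.ext h
    · rintro ⟨c, hc⟩
      obtain ⟨i, rfl⟩ := hZgen c
      have he : (i % p ^ k) • Pz = i • Pz := (hnsmul _ _).mpr (by rw [ZMod.natCast_mod])
      refine ⟨⟨i % p ^ k, (@Finset.mem_filter ℕ _ inst _ _).mpr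
        ⟨Finset.mem_range.mpr (Nat.mod_lt _ (NeZero.pos _)), ?_⟩⟩, Subtype.ext he⟩
      rw [he]; exact (hρτ _).mpr hc
  have hup : Nat.card {f : C →+ MuCarrier F (p ^ k) // ∀ (h : H) (m : C),
      f (ρ (h : Γ) m) = mu F (p ^ k) (h : Γ) (f m)} ≤ Nat.card {c : C // τ • (c : P) = c} := by
    have h1 := natCard_equivariant_le_card_filter H ρ (mu F (p ^ k)) (muEquivZMod F (p ^ k)) hPzord hZgen hτH hτω hb'
    exact h1.trans (le_of_eq (hcount _))
  -- (3) lower bound: `#C^τ = #H²(Γ_F, C) = #(Hom(C, μ))^{Γ} ≤ #Hom_H(C, μ)`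
  have hlow : Nat.card {c : C // τ • (c : P) = c} ≤ Nat.card {f : C →+ MuCarrier F (p ^ k) // ∀ (h : H) (m : C),
      f (ρ (h : Γ) m) = mu F (p ^ k) (h : Γ) (f m)} := by
    rw [← hΓ, hdualΓ]
    refine Nat.card_le_card_of_injective (fun Θ ↦ ⟨((Θ : HomCarrier C (MuCarrier F (p ^ k))) : C →+ MuCarrier F (p ^ k)),
      fun h m ↦ ((ContinuousRep.homRep_apply_eq_self_iff ρ (mu F (p ^ k)) (h : Γ)
        (Θ : HomCarrier C (MuCarrier F (p ^ k)))).mp (Θ.2 (h : Γ)) m).symm⟩) ?_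
    intro Θ Θ' hΘ
    exact Subtype.ext (HomCarrier.ext fun m ↦ by
      have h := congrArg (fun f : {f : C →+ MuCarrier F (p ^ k) // ∀ (h : H) (m : C),
          f (ρ (h : Γ) m) = mu F (p ^ k) (h : Γ) (f m)} ↦ (f.1 m)) hΘ
      exact h)
  exact le_antisymm hup hlow

end Summit.BirchSwinnertonDyer.BirchSwinnertonDyer.Theorems.InputsGreenbergLemma34Layer

end
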